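import Mathlib
import Summits.AnomalousDissipation.AnomalousDissipation.Theorems.MarginalStabilityChainStretchedVortexRowsStubRowVorticityConstructionToolsApprox
import Summits.AnomalousDissipation.AnomalousDissipation.Theorems.MarginalStabilityChainStretchedVortexRowsStubRowVorticityConstructionToolsDiv

/-!
# Stub `stub_rowVorticityConstruction` (crux stmt-AnomalousDissipation-3009) — tools XIII:
# the Poisson equation `ΔΨ = 4πω` on the cylinder and the curl identity `∂ₓv − ∂_yu = ω`

Helper file (supports stmt-AnomalousDissipation-3009). Last brick of the CYLINDER BIOT–SAVART LAW: for `L > 0` and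
an `L`-periodic `ω ∈ C²` with Gaussian bounds on `ω, Dω, D²ω`,

* `integral_rowLogKer_mul_lap` — `∫_{S_L} Φ_L(q) (Δω)(x − q₁, y − q₂) dq = 4π ω(x, y)`: both sides are the
  `ε → 0⁺` limits of the two sides of Green's identity for `Φ_ε^L` (tools XI/XII: `Φ_ε^L → Φ_L` under the integral,
  `ΔΦ_ε^L` an approximate identity of mass `4π`), and limits in `ℝ` are unique;
* `lap_rowStream` — `Δ ∫_{S_L} Φ_L ω(· − q) = ∫_{S_L} Φ_L (Δω)(· − q)` (slice derivatives under the integral twice,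
  tools II), hence **`ΔΨ = 4πω`**;
* **`curl_rowBS`** — with `u = −(2L)⁻¹∫K₁ω(· − q) = −(4π)⁻¹∂_yΨ`, `v = (2L)⁻¹∫K₂ω(· − q) = (4π)⁻¹∂ₓΨ` (tools VII):
  `∂ₓv − ∂_yu = (4π)⁻¹ΔΨ = ω`. Together with tools IV–VII this completes: the cylinder Biot–Savart velocity of
  `ω` is `Cⁿ`, `L`-periodic, point-antisymmetric for point-symmetric `ω`, divergence free, has curl `ω`, and has
  the shear far field `u → ∓M/(2L)`, `v → 0`.
Registered sub-goal proved here: `stub_rowVorticityConstruction_biotSavartCurl`. All `[folklore]`.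
-/

set_option linter.dupNamespace false

noncomputable section

open Real Set Filter Topology MeasureTheory
open Literature.Analysis.FluidPDE Literature.Analysis.FluidPDE.StretchedLayer

namespace Summit.AnomalousDissipation.AnomalousDissipation.Theorems.MarginalStabilityChainStretchedVortexRows.RowBiotSavart

section Poisson

variable {L : ℝ} {ω : ℝ → ℝ → ℝ}

/-- The Laplacian of a `C²` field with Gaussian bounds on `D²ω` is continuous and Gaussian-bounded. [folklore] -/
theorem lap_continuous_and_bound (hω : ContDiff ℝ 2 fun p : ℝ × ℝ => ω p.1 p.2) {C₂ a₂ : ℝ}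
    (hb₂ : ∀ p, ‖iteratedFDeriv ℝ 2 (fun p : ℝ × ℝ => ω p.1 p.2) p‖ ≤ C₂ * Real.exp (-a₂ * p.2 ^ 2)) :
    Continuous (fun p : ℝ × ℝ => lap ω p.1 p.2) ∧ ∀ a b, |lap ω a b| ≤ 2 * C₂ * Real.exp (-a₂ * b ^ 2) := by
  constructor
  · simp only [lap_apply]
    exact (continuous_dX (contDiff_one_dX hω)).add (continuous_dY (contDiff_one_dY hω))
  · intro a b
    rw [lap_apply]
    have h1 := abs_dX_dX_le hω hb₂ a b
    have h2 := abs_dY_dY_le hω hb₂ a b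
    calc _ ≤ |dX (dX ω) a b| + |dY (dY ω) a b| := abs_add_le _ _
      _ ≤ _ := by linarith

/-- **`∫_{S_L} Φ_L(q) (Δω)(x − q₁, y − q₂) dq = 4π ω(x, y)`** for `ω ∈ C²`, `L`-periodic, with Gaussian bounds on
`ω, Dω, D²ω`. [folklore] -/
theorem integral_rowLogKer_mul_lap (hL : 0 < L) (hω : ContDiff ℝ 2 fun p : ℝ × ℝ => ω p.1 p.2)
    (hB : ∀ i ≤ 2, ∃ C a : ℝ, 0 < a ∧
      ∀ p, ‖iteratedFDeriv ℝ i (fun p : ℝ × ℝ => ω p.1 p.2) p‖ ≤ C * Real.exp (-a * p.2 ^ 2))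
    (hper : ∀ x y, ω (x + L) y = ω x y) (x y : ℝ) :
    ∫ q in Ioc (-(L / 2)) (L / 2) ×ˢ (univ : Set ℝ),
        Real.log (Real.cosh (2 * π * q.2 / L) - Real.cos (2 * π * q.1 / L)) * lap ω (x - q.1) (y - q.2) =
      4 * π * ω x y := by
  obtain ⟨⟨C, a, ha, hb⟩, -⟩ := gaussBounds_of_iterated (ω := ω) fun i hi => hB i (hi.trans one_le_two)
  obtain ⟨C₂, a₂, ha₂, hb₂⟩ := hB 2 le_rfl
  obtain ⟨hlc, hlb⟩ := lap_continuous_and_bound hω hb₂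
  -- left side: `Φ_ε → Φ`
  have hF := tendsto_integral_rowLogKerReg_mul hL hlc ha₂ hlb x y
  -- right side: approximate identity against `q ↦ ω(x − q₁, y − q₂)`
  have hC : 0 ≤ C := by have := (abs_nonneg _).trans (hb 0 0); simpa using this
  have hh : Continuous fun q : ℝ × ℝ => ω (x - q.1) (y - q.2) :=
    hω.continuous.comp ((continuous_const.sub continuous_fst).prodMk (continuous_const.sub continuous_snd))
  have hM : ∀ q : ℝ × ℝ, |ω (x - q.1) (y - q.2)| ≤ C := fun q => (hb _ _).trans (by
    have : Real.exp (-a * (y - q.2) ^ 2) ≤ 1 := by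
      rw [Real.exp_le_one_iff]; nlinarith [sq_nonneg (y - q.2)]
    nlinarith)
  have hG := tendsto_integral_lap_mul hL hh hM
  simp only [Prod.fst_zero, Prod.snd_zero, sub_zero] at hG
  -- the two sides agree for `0 < ε < 1`
  have hFG : (fun ε => ∫ q in Ioc (-(L / 2)) (L / 2) ×ˢ (univ : Set ℝ),
      Real.log (Real.cosh (2 * π * q.2 / L) - Real.cos (2 * π * q.1 / L) + ε) * lap ω (x - q.1) (y - q.2)) =ᶠ[𝓝[>] 0]
      fun ε => ∫ q in Ioc (-(L / 2)) (L / 2) ×ˢ (univ : Set ℝ),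
        (2 * π / L) ^ 2 * (ε * (Real.cosh (2 * π * q.2 / L) + Real.cos (2 * π * q.1 / L)) /
          (Real.cosh (2 * π * q.2 / L) - Real.cos (2 * π * q.1 / L) + ε) ^ 2) * ω (x - q.1) (y - q.2) := by
    filter_upwards [Ioo_mem_nhdsGT (zero_lt_one' ℝ)] with ε hε
    exact green_strip_reg hL hε.1 hε.2.le hω hB hper x y
  exact tendsto_nhds_unique_of_eventuallyEq hF hG hFG

/-- **`ΔΨ = ∫ Φ_L (Δω)(· − q)`**: the Laplacian passes under the stream integral (`ω ∈ C²` with Gaussian bounds on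
`ω, Dω, D²ω`). [folklore] -/
theorem lap_rowStream (hL : 0 < L) (hω : ContDiff ℝ 2 fun p : ℝ × ℝ => ω p.1 p.2)
    (hB : ∀ i ≤ 2, ∃ C a : ℝ, 0 < a ∧
      ∀ p, ‖iteratedFDeriv ℝ i (fun p : ℝ × ℝ => ω p.1 p.2) p‖ ≤ C * Real.exp (-a * p.2 ^ 2)) (x y : ℝ) :
    lap (fun a b => ∫ q in Ioc (-(L / 2)) (L / 2) ×ˢ (univ : Set ℝ),
        Real.log (Real.cosh (2 * π * q.2 / L) - Real.cos (2 * π * q.1 / L)) * ω (a - q.1) (b - q.2)) x y =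
      ∫ q in Ioc (-(L / 2)) (L / 2) ×ˢ (univ : Set ℝ),
        Real.log (Real.cosh (2 * π * q.2 / L) - Real.cos (2 * π * q.1 / L)) * lap ω (x - q.1) (y - q.2) := by
  have hω1 : ContDiff ℝ 1 fun p : ℝ × ℝ => ω p.1 p.2 := hω.of_le one_le_two
  obtain ⟨⟨C, a, ha, hb⟩, ⟨C', a', ha', hb'⟩⟩ := gaussBounds_of_iterated (ω := ω) fun i hi => hB i (hi.trans one_le_two)
  obtain ⟨C₂, a₂, ha₂, hb₂⟩ := hB 2 le_rfl
  set μ : Measure (ℝ × ℝ) := (volume : Measure (ℝ × ℝ)).restrict (Ioc (-(L / 2)) (L / 2) ×ˢ (univ : Set ℝ))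
  have hk := (measurable_rowLogKer L).aestronglyMeasurable (μ := μ)
  have hki := gaussTestable_rowLogKer hL
  -- Gaussian bounds on the derivative fields `dX ω`, `dY ω` and on their derivatives
  have cX : ContDiff ℝ 1 fun p : ℝ × ℝ => dX ω p.1 p.2 := contDiff_one_dX hω
  have cY : ContDiff ℝ 1 fun p : ℝ × ℝ => dY ω p.1 p.2 := contDiff_one_dY hω
  have bX : ∀ a₀ b, |dX ω a₀ b| ≤ C' * Real.exp (-a' * b ^ 2) := fun a₀ b => abs_dX_le hω1 hb' a₀ b
  have bY : ∀ a₀ b, |dY ω a₀ b| ≤ C' * Real.exp (-a' * b ^ 2) := fun a₀ b => abs_dY_le hω1 hb' a₀ b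
  have hB2 : ∀ i ≤ 1 + 1, ∃ C a : ℝ, 0 < a ∧
      ∀ p, ‖iteratedFDeriv ℝ i (fun p : ℝ × ℝ => ω p.1 p.2) p‖ ≤ C * Real.exp (-a * p.2 ^ 2) := hB
  have nf : ∀ (F : ℝ × ℝ → ℝ) (p : ℝ × ℝ), ‖fderiv ℝ F p‖ = ‖iteratedFDeriv ℝ 1 F p‖ := fun F p => by
    rw [← norm_iteratedFDeriv_fderiv, norm_iteratedFDeriv_zero]
  obtain ⟨C₃, a₃, ha₃, hb₃⟩ := gaussBound_fderiv_apply (n := 1) hω hB2 ((1:ℝ), (0:ℝ)) 1 le_rfl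
  obtain ⟨C₄, a₄, ha₄, hb₄⟩ := gaussBound_fderiv_apply (n := 1) hω hB2 ((0:ℝ), (1:ℝ)) 1 le_rfl
  have bX' : ∀ p, ‖fderiv ℝ (fun p : ℝ × ℝ => dX ω p.1 p.2) p‖ ≤ C₃ * Real.exp (-a₃ * p.2 ^ 2) := fun p => by
    rw [dX_uncurry_eq hω1, nf]; exact hb₃ p
  have bY' : ∀ p, ‖fderiv ℝ (fun p : ℝ × ℝ => dY ω p.1 p.2) p‖ ≤ C₄ * Real.exp (-a₄ * p.2 ^ 2) := fun p => by
    rw [dY_uncurry_eq hω1, nf]; exact hb₄ p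
  -- first derivatives of the stream integral, as functions
  have h1X : dX (fun a b => ∫ q, Real.log (Real.cosh (2 * π * q.2 / L) - Real.cos (2 * π * q.1 / L)) *
      ω (a - q.1) (b - q.2) ∂μ) = fun a b => ∫ q, Real.log (Real.cosh (2 * π * q.2 / L) - Real.cos (2 * π * q.1 / L)) *
      dX ω (a - q.1) (b - q.2) ∂μ :=
    funext fun a => funext fun b => dX_rowConv hk hki hω1 ha hb ha' hb' a b
  have h1Y : dY (fun a b => ∫ q, Real.log (Real.cosh (2 * π * q.2 / L) - Real.cos (2 * π * q.1 / L)) *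
      ω (a - q.1) (b - q.2) ∂μ) = fun a b => ∫ q, Real.log (Real.cosh (2 * π * q.2 / L) - Real.cos (2 * π * q.1 / L)) *
      dY ω (a - q.1) (b - q.2) ∂μ :=
    funext fun a => funext fun b => dY_rowConv hk hki hω1 ha hb ha' hb' a b
  rw [lap_apply, h1X, h1Y, dX_rowConv hk hki cX ha' bX ha₃ bX' x y, dY_rowConv hk hki cY ha' bY ha₄ bY' x y]
  -- recombine
  have bXX : ∀ p : ℝ × ℝ, ‖(fun p : ℝ × ℝ => dX (dX ω) p.1 p.2) p‖ ≤ C₂ * Real.exp (-a₂ * p.2 ^ 2) := fun p => by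
    rw [Real.norm_eq_abs]; exact abs_dX_dX_le hω hb₂ p.1 p.2
  have bYY : ∀ p : ℝ × ℝ, ‖(fun p : ℝ × ℝ => dY (dY ω) p.1 p.2) p‖ ≤ C₂ * Real.exp (-a₂ * p.2 ^ 2) := fun p => by
    rw [Real.norm_eq_abs]; exact abs_dY_dY_le hω hb₂ p.1 p.2
  have iXX : Integrable (fun q : ℝ × ℝ => Real.log (Real.cosh (2 * π * q.2 / L) - Real.cos (2 * π * q.1 / L)) *
      dX (dX ω) (x - q.1) (y - q.2)) μ := by
    have := integrable_ker_smul hk hki (continuous_dX cX) ha₂ bXX (x, y)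
    simpa only [smul_eq_mul, Prod.fst_sub, Prod.snd_sub] using this
  have iYY : Integrable (fun q : ℝ × ℝ => Real.log (Real.cosh (2 * π * q.2 / L) - Real.cos (2 * π * q.1 / L)) *
      dY (dY ω) (x - q.1) (y - q.2)) μ := by
    have := integrable_ker_smul hk hki (continuous_dY cY) ha₂ bYY (x, y)
    simpa only [smul_eq_mul, Prod.fst_sub, Prod.snd_sub] using this
  rw [← integral_add iXX iYY]
  refine integral_congr_ae (Eventually.of_forall fun q => ?_)
  simp only [lap_apply]; ring

/-- **The curl of the cylinder Biot–Savart velocity is the vorticity**: for `ω ∈ C²`, `L`-periodic in `x`, with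
Gaussian bounds on `ω, Dω, D²ω`, `∂ₓv − ∂_yu = ω` for `u = −(2L)⁻¹ ∫_{S_L} K₁ ω(· − q)`,
`v = (2L)⁻¹ ∫_{S_L} K₂ ω(· − q)`. [folklore] -/
theorem curl_rowBS (hL : 0 < L) (hω : ContDiff ℝ 2 fun p : ℝ × ℝ => ω p.1 p.2)
    (hB : ∀ i ≤ 2, ∃ C a : ℝ, 0 < a ∧
      ∀ p, ‖iteratedFDeriv ℝ i (fun p : ℝ × ℝ => ω p.1 p.2) p‖ ≤ C * Real.exp (-a * p.2 ^ 2))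
    (hper : ∀ x y, ω (x + L) y = ω x y) (x y : ℝ) :
    dX (fun a b => 1 / (2 * L) * ∫ q in Ioc (-(L / 2)) (L / 2) ×ˢ (univ : Set ℝ),
        Real.sin (2 * π * q.1 / L) / (Real.cosh (2 * π * q.2 / L) - Real.cos (2 * π * q.1 / L)) *
          ω (a - q.1) (b - q.2)) x y -
      dY (fun a b => -(1 / (2 * L)) * ∫ q in Ioc (-(L / 2)) (L / 2) ×ˢ (univ : Set ℝ),
        Real.sinh (2 * π * q.2 / L) / (Real.cosh (2 * π * q.2 / L) - Real.cos (2 * π * q.1 / L)) *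
          ω (a - q.1) (b - q.2)) x y = ω x y := by
  have hω1 : ContDiff ℝ 1 fun p : ℝ × ℝ => ω p.1 p.2 := hω.of_le one_le_two
  obtain ⟨⟨C, a, ha, hb⟩, ⟨C', a', ha', hb'⟩⟩ := gaussBounds_of_iterated (ω := ω) fun i hi => hB i (hi.trans one_le_two)
  set Ψ : ℝ → ℝ → ℝ := fun a b => ∫ q in Ioc (-(L / 2)) (L / 2) ×ˢ (univ : Set ℝ),
    Real.log (Real.cosh (2 * π * q.2 / L) - Real.cos (2 * π * q.1 / L)) * ω (a - q.1) (b - q.2) with hΨ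
  have hπ : (π : ℝ) ≠ 0 := Real.pi_pos.ne'
  have hu : (fun a b => -(1 / (2 * L)) * ∫ q in Ioc (-(L / 2)) (L / 2) ×ˢ (univ : Set ℝ),
      Real.sinh (2 * π * q.2 / L) / (Real.cosh (2 * π * q.2 / L) - Real.cos (2 * π * q.1 / L)) *
        ω (a - q.1) (b - q.2)) = fun a b => -(1 / (4 * π)) * dY Ψ a b := by
    funext a b
    rw [hΨ, dY_rowStream hL hω1 ha hb ha' hb' a b]
    field_simp
    ring
  have hv : (fun a b => 1 / (2 * L) * ∫ q in Ioc (-(L / 2)) (L / 2) ×ˢ (univ : Set ℝ),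
      Real.sin (2 * π * q.1 / L) / (Real.cosh (2 * π * q.2 / L) - Real.cos (2 * π * q.1 / L)) *
        ω (a - q.1) (b - q.2)) = fun a b => 1 / (4 * π) * dX Ψ a b := by
    funext a b
    rw [hΨ, dX_rowStream hL hω1 ha hb ha' hb' hper a b]
    field_simp
    ring
  have hlap : lap Ψ x y = 4 * π * ω x y := by
    rw [hΨ, lap_rowStream hL hω hB x y, integral_rowLogKer_mul_lap hL hω hB hper x y]
  rw [hu, hv, dX_const_mul, dY_const_mul]
  rw [lap_apply] at hlap
  field_simp
  linear_combination hlap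

end Poisson

end RowBiotSavart

open RowBiotSavart in
/-- **The cylinder Biot–Savart velocity has curl `ω`** (registered on stmt-AnomalousDissipation-3009 as the helper
stub `stub_rowVorticityConstruction_biotSavartCurl` of `stub_rowVorticityConstruction`): for `L > 0` and an
`L`-periodic `ω ∈ C²` with Gaussian bounds on `ω, Dω, D²ω`, the fields
`u = −(2L)⁻¹ ∫_{S_L} K₁(q) ω(x − q₁, y − q₂) dq`, `v = (2L)⁻¹ ∫_{S_L} K₂(q) ω(x − q₁, y − q₂) dq` satisfy
`∂ₓv − ∂_yu = ω` pointwise — the vorticity clause `ω = ∂ₓv − ∂_yu` of the stub's conclusion for the reconstructed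
velocity (`RowBiotSavart.curl_rowBS`: the Poisson equation `ΔΨ = 4πω` for the cylinder Green's function
`(4π)⁻¹ log(cosh(2πy/L) − cos(2πx/L))`). [folklore] -/
theorem stub_rowVorticityConstruction_biotSavartCurl :
    ∀ (L : ℝ) (ω : ℝ → ℝ → ℝ), 0 < L → ContDiff ℝ 2 (fun p : ℝ × ℝ => ω p.1 p.2) →
      (∀ i ≤ 2, ∃ C a : ℝ, 0 < a ∧
        ∀ p : ℝ × ℝ, ‖iteratedFDeriv ℝ i (fun p : ℝ × ℝ => ω p.1 p.2) p‖ ≤ C * Real.exp (-a * p.2 ^ 2)) →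
      (∀ x y, ω (x + L) y = ω x y) →
      ∀ x y : ℝ,
        dX (fun a b => 1 / (2 * L) * ∫ q in Set.Ioc (-(L / 2)) (L / 2) ×ˢ (Set.univ : Set ℝ),
            Real.sin (2 * Real.pi * q.1 / L) / (Real.cosh (2 * Real.pi * q.2 / L) - Real.cos (2 * Real.pi * q.1 / L)) *
              ω (a - q.1) (b - q.2)) x y -
          dY (fun a b => -(1 / (2 * L)) * ∫ q in Set.Ioc (-(L / 2)) (L / 2) ×ˢ (Set.univ : Set ℝ),
            Real.sinh (2 * Real.pi * q.2 / L) / (Real.cosh (2 * Real.pi * q.2 / L) - Real.cos (2 * Real.pi * q.1 / L)) *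
              ω (a - q.1) (b - q.2)) x y = ω x y :=
  fun _ _ hL hω hB hper x y => curl_rowBS hL hω hB hper x y

end Summit.AnomalousDissipation.AnomalousDissipation.Theorems.MarginalStabilityChainStretchedVortexRows

end
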